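import Mathlib.LinearAlgebra.Matrix.PosDef
import Literature.MathematicalPhysics.QuantumFieldTheory.Balaban1983to89.Node00.Record12NumericsFamilyDict

/-!
# NODE 00 (YM-PLAN Track A) — PRINT'S TRACE STATE ON THE COEFFICIENT ALGEBRA OF THE DICTIONARY OF RECORD (`𝔸 = M₂(ℂ)`, RECORD-NONABELIAN)

After the RECORD-NONABELIAN RE-KEY (director-ym №256 (2) ∕ №268, `Node00/Record12Numerics.lean` :200 `𝔸 := Matrix (Fin 2) (Fin 2) ℂ`,
`instCStar := B10Eq29TubeLine.cstarAlgebraMatrix 2` = `M₂(ℂ)` with the `L²`-operator norm) the coefficient C⋆-algebra of the dictionary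
of record `stage3OfRecord₁₂` — and of every family dictionary `stage3OfFamily F`, which inherits the field (`Record12NumericsFamilyDict`,
`Record12NumericsColourTie.stage3OfFamily_𝔸_eq_record`) — CARRIES PRINT'S TRACE STATE: the (normalised) matrix trace of
[Balaban1987RG1] (0.2) p.252 («tr is the normalized trace, i.e. tr 1 = 1», `G ⊂ U(N)`), on the `N × N` complex matrices in which
[Balaban1985RegularSpaces] p.76 takes its configurations' values.

WHY THIS LEAF.  The K1 face of record of node N24 (`Summits/…/BalabanUVNodesN24K1FaceN06OYN07N08Junction…ZYP`, p705524, and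
its whole lineage since p650613) DISPLAYS, inside the N05∕N06-slot hypothesis `hN06`, a trace state on `(stage3OfFamily F).𝔸` as
∃-bound DATA the face's user must supply: `τ : 𝔸 →ₗ[ℂ] ℂ`, `C_τ : ℝ` with (i) `a ≠ 0 → 0 < Re τ(a⋆a)` (faithful), (ii) `τ(ab) = τ(ba)`
(tracial), (iii) `τ(a⋆) = conj (τ a)` (⋆-compatible), (iv) `|Re τ(x⋆y)| ≤ C_τ‖x‖‖y‖` — the hypotheses under which dag-n06-b's
`B9Thm33BindersUniformZdPerNestedEta.IdxB8SubDPerκ.binders_uniform` and dag-n05-d's ζ-L door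
`exists_residB8_slot8κ'_of_bindersLettersPer_doorL` are UNIFORM in `τ`.  While the record read `𝔸 := ℂ` the display was an
abelian-instance reading (FLAG №14); at the re-keyed record the four clauses are THEOREMS about `M₂(ℂ)`: this file proves them, so
the next K1-face edition takes `(τ, C_τ)` OFF its displayed bill (one `obtain` on `exists_traceState_stage3OfFamily F`).

CONTENTS (theorems only; 0 `def`, 0 `sorry`, 0 `instance`, 0 `notation`; standard axioms).
§1 `TraceStateOfRecord.*` — matrix analysis under Mathlib's scoped `L²`-operator norm (`Matrix.Norms.L2Operator`) at `ℂ` (the four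
unstarred lemmas are PRIVATE folklore helpers): `norm_entry_le_l2_opNorm` (`‖A i j‖ ≤ ‖A‖`, from `Matrix.l2_opNorm_mulVec` at `EuclideanSpace.single j 1`),
`norm_trace_le_card_mul_l2_opNorm` (`‖tr A‖ ≤ n‖A‖`), `abs_re_trace_conjTranspose_mul_le` (`|Re tr(x† y)| ≤ n‖x‖‖y‖`, with
`Matrix.l2_opNorm_mul` ∕ `l2_opNorm_conjTranspose`), `re_trace_conjTranspose_mul_self_pos` (`a ≠ 0 → 0 < Re tr(a†a)`, from
`Matrix.posSemidef_conjTranspose_mul_self` + `trace_conjTranspose_mul_self_eq_zero_iff`), ★ `exists_traceState n` (`τ := Matrix.traceLinearMap`,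
`C_τ := n`) and ★ `exists_normalizedTraceState n` (`τ := n⁻¹ • trace`, `τ 1 = 1`, `C_τ := 1`; `1 ≤ n`).
§2 at the dictionaries: ★★ `exists_traceState_stage3OfRecord₁₂` ∕ ★★ `exists_traceState_stage3OfFamily F` — the four displayed clauses
VERBATIM in the K1 face's binder shape (`unfold stage3OfFamily stage3OfRecord₁₂; exact exists_traceState _`: the carried
`instCStar` IS Mathlib's scoped matrix C⋆-structure, so `star = conjTranspose` and `‖·‖ =` the `L²`-operator norm definitionally; the STATEMENTS key the
carrier BY NAME (`stage3OfRecord₁₂.𝔸`, `(stage3OfFamily F).𝔸`) and the proofs leave the matrix size to unification, so a re-key of the record's colour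
number touches nothing here — node00-def-RR-2's request I.46250) —
and the normalised twins `exists_normalizedTraceState_stage3OfRecord₁₂ ∕ _stage3OfFamily` (`τ 1 = 1`, `C_τ = 1`, print-literal).

HONEST FRAMING.  Finite-dimensional linear algebra on the tree's own dictionary; nothing of Bałaban's is asserted; no proviso, key,
datum key or pin is touched; the N05∕N06 slot's CONTENT ([4]'s operators and letters, the Hölder pair) is untouched — only its
trace-state DATA is witnessed; K0⁷ `Record13SepCoPHInhabited` is NOT inhabited here; no node count and no K-display moves;
COUNT-NEUTRAL.  One finite `𝕋⁴` programme at fixed `ε = L^{−K}` — NOT the continuum limit on `ℝ⁴`, NOT infinite volume, NOT OS,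
NOT a mass gap, NOT the Clay problem.  A NEW zero-dependant leaf beside `Record12NumericsFamilyFiniteDim` ∕ `Record12NumericsColourTie`
(no edition of `Record12Numerics.lean`, no reverse-cone rebuild).  Seat `pub-ymgap-dag-n24-c` (R134 N24 s2, gen 16).
-/

noncomputable section

open scoped Matrix.Norms.L2Operator ComplexOrder
open Matrix

namespace Literature.MathematicalPhysics.QuantumFieldTheory.Balaban1983to89.Node00

open T4Continuum

/-! ## §1. The trace state on `M_n(ℂ)` with the `L²`-operator norm -/

namespace TraceStateOfRecord

section Matrices

variable {m n : Type*} [Fintype m] [Fintype n] [DecidableEq n]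

/-- **Entry bound under the `L²`-operator norm**: `‖A i j‖ ≤ ‖A‖` (the entry is the `i`-th coordinate of `A e_j`, and
`‖A e_j‖ ≤ ‖A‖‖e_j‖ = ‖A‖`). [folklore] -/
private theorem norm_entry_le_l2_opNorm (A : Matrix m n ℂ) (i : m) (j : n) : ‖A i j‖ ≤ ‖A‖ := by
  have h := Matrix.l2_opNorm_mulVec A (EuclideanSpace.single j (1 : ℂ))
  rw [PiLp.norm_single, norm_one, mul_one] at h
  refine le_trans ?_ h
  have hc := PiLp.norm_apply_le ((EuclideanSpace.equiv m ℂ).symm (A *ᵥ ⇑(EuclideanSpace.single j (1 : ℂ)))) i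
  have hij : ((EuclideanSpace.equiv m ℂ).symm (A *ᵥ ⇑(EuclideanSpace.single j (1 : ℂ)))) i = A i j := by
    simp
  rw [hij] at hc
  exact hc

/-- **`‖tr A‖ ≤ n · ‖A‖`** for the `L²`-operator norm (`n = |index set|`), by the entry bound on the diagonal. [folklore] -/
private theorem norm_trace_le_card_mul_l2_opNorm (A : Matrix n n ℂ) : ‖A.trace‖ ≤ Fintype.card n * ‖A‖ := by
  rw [Matrix.trace]
  calc ‖∑ i, A.diag i‖ ≤ ∑ i, ‖A.diag i‖ := norm_sum_le _ _
    _ ≤ ∑ _i : n, ‖A‖ := Finset.sum_le_sum fun i _ => norm_entry_le_l2_opNorm A i i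
    _ = Fintype.card n * ‖A‖ := by simp

/-- **`|Re tr(x† y)| ≤ n · ‖x‖ · ‖y‖`** for the `L²`-operator norm (`‖x† y‖ ≤ ‖x†‖‖y‖ = ‖x‖‖y‖`). [folklore] -/
private theorem abs_re_trace_conjTranspose_mul_le (x y : Matrix n n ℂ) :
    |((xᴴ * y).trace).re| ≤ Fintype.card n * ‖x‖ * ‖y‖ := by
  calc |((xᴴ * y).trace).re| ≤ ‖(xᴴ * y).trace‖ := Complex.abs_re_le_norm _
    _ ≤ Fintype.card n * ‖xᴴ * y‖ := norm_trace_le_card_mul_l2_opNorm _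
    _ ≤ Fintype.card n * (‖x‖ * ‖y‖) := by
        gcongr
        calc ‖xᴴ * y‖ ≤ ‖xᴴ‖ * ‖y‖ := Matrix.l2_opNorm_mul _ _
          _ = ‖x‖ * ‖y‖ := by rw [Matrix.l2_opNorm_conjTranspose]
    _ = Fintype.card n * ‖x‖ * ‖y‖ := by ring

omit [DecidableEq n] in
/-- **Faithfulness of the trace**: `a ≠ 0 → 0 < Re tr(a† a)` (`a† a` is positive semidefinite with trace `Σ |a i j|²`, zero iff
`a = 0`). [folklore] -/
private theorem re_trace_conjTranspose_mul_self_pos (a : Matrix n n ℂ) (ha : a ≠ 0) : 0 < ((aᴴ * a).trace).re := by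
  have h0 : (0 : ℂ) ≤ (aᴴ * a).trace := (posSemidef_conjTranspose_mul_self a).trace_nonneg
  have hne : (aᴴ * a).trace ≠ 0 := fun h => ha (trace_conjTranspose_mul_self_eq_zero_iff.mp h)
  obtain ⟨hre, him⟩ := Complex.nonneg_iff.mp h0
  rcases hre.lt_or_eq with hlt | heq
  · exact hlt
  · exfalso; apply hne; apply Complex.ext <;> simp [← heq, ← him]

/-- ★ **The trace state on `M_n(ℂ)`** (`L²`-operator norm): `τ := tr` (as a `ℂ`-linear map) is FAITHFUL, TRACIAL, ⋆-COMPATIBLE and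
satisfies `|Re τ(x⋆ y)| ≤ C_τ ‖x‖ ‖y‖` with `C_τ := n` — the four clauses displayed by node N24's K1 face for the N05∕N06 slot.
[cite: Balaban1987RG1, (0.2) p.252 (the trace on `G ⊂ U(N) ⊂ M_N(ℂ)`); Balaban1985RegularSpaces, p.76, (1.1) (values in complex `N × N` matrices) (bookkeeping)] -/
theorem exists_traceState (n : ℕ) :
    ∃ (τ : Matrix (Fin n) (Fin n) ℂ →ₗ[ℂ] ℂ) (Cτ : ℝ),
      (∀ a : Matrix (Fin n) (Fin n) ℂ, a ≠ 0 → 0 < (τ (star a * a)).re) ∧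
      (∀ a b : Matrix (Fin n) (Fin n) ℂ, τ (a * b) = τ (b * a)) ∧
      (∀ a : Matrix (Fin n) (Fin n) ℂ, τ (star a) = starRingEnd ℂ (τ a)) ∧
      (∀ x y : Matrix (Fin n) (Fin n) ℂ, |(τ (star x * y)).re| ≤ Cτ * ‖x‖ * ‖y‖) := by
  refine ⟨Matrix.traceLinearMap (Fin n) ℂ ℂ, Fintype.card (Fin n), ?_, ?_, ?_, ?_⟩
  · intro a ha
    simpa [Matrix.traceLinearMap_apply, Matrix.star_eq_conjTranspose] using re_trace_conjTranspose_mul_self_pos a ha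
  · intro a b
    simp only [Matrix.traceLinearMap_apply]
    exact Matrix.trace_mul_comm a b
  · intro a
    simp [Matrix.traceLinearMap_apply, Matrix.star_eq_conjTranspose, Matrix.trace_conjTranspose]
  · intro x y
    simpa [Matrix.traceLinearMap_apply, Matrix.star_eq_conjTranspose] using abs_re_trace_conjTranspose_mul_le x y

/-- ★ **Print's NORMALISED trace state on `M_n(ℂ)`, `1 ≤ n`**: `τ := n⁻¹ · tr`, `τ 1 = 1` ([Balaban1987RG1] (0.2): «tr is the normalized
trace, i.e. tr 1 = 1»), faithful, tracial, ⋆-compatible, with `|Re τ(x⋆ y)| ≤ ‖x‖ ‖y‖` (`C_τ := 1`).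
[cite: Balaban1987RG1, (0.2) p.252; Balaban1985RegularSpaces, p.76, (1.1) (bookkeeping)] -/
theorem exists_normalizedTraceState (n : ℕ) (hn : 1 ≤ n) :
    ∃ (τ : Matrix (Fin n) (Fin n) ℂ →ₗ[ℂ] ℂ) (Cτ : ℝ), τ 1 = 1 ∧ Cτ = 1 ∧
      (∀ a : Matrix (Fin n) (Fin n) ℂ, a ≠ 0 → 0 < (τ (star a * a)).re) ∧
      (∀ a b : Matrix (Fin n) (Fin n) ℂ, τ (a * b) = τ (b * a)) ∧
      (∀ a : Matrix (Fin n) (Fin n) ℂ, τ (star a) = starRingEnd ℂ (τ a)) ∧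
      (∀ x y : Matrix (Fin n) (Fin n) ℂ, |(τ (star x * y)).re| ≤ Cτ * ‖x‖ * ‖y‖) := by
  have hn0 : (0 : ℝ) < n := by exact_mod_cast hn
  refine ⟨((n : ℝ)⁻¹ : ℂ) • Matrix.traceLinearMap (Fin n) ℂ ℂ, 1, ?_, rfl, ?_, ?_, ?_, ?_⟩
  · rw [LinearMap.smul_apply, Matrix.traceLinearMap_apply, Matrix.trace_one, Fintype.card_fin, smul_eq_mul]
    have hc : ((n : ℝ) : ℂ) = (n : ℂ) := by norm_cast
    rw [hc]
    exact inv_mul_cancel₀ (by exact_mod_cast hn0.ne')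
  · intro a ha
    rw [LinearMap.smul_apply, smul_eq_mul, ← Complex.ofReal_inv, Complex.re_ofReal_mul, Matrix.traceLinearMap_apply,
      Matrix.star_eq_conjTranspose]
    exact mul_pos (inv_pos.mpr hn0) (re_trace_conjTranspose_mul_self_pos a ha)
  · intro a b
    simp only [LinearMap.smul_apply, Matrix.traceLinearMap_apply, Matrix.trace_mul_comm a b]
  · intro a
    simp [Matrix.traceLinearMap_apply, Matrix.star_eq_conjTranspose, Matrix.trace_conjTranspose]
  · intro x y
    rw [LinearMap.smul_apply, smul_eq_mul, ← Complex.ofReal_inv, Complex.re_ofReal_mul, Matrix.traceLinearMap_apply,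
      Matrix.star_eq_conjTranspose, one_mul, abs_mul, abs_of_pos (inv_pos.mpr hn0)]
    have hb := abs_re_trace_conjTranspose_mul_le x y
    simp only [Fintype.card_fin] at hb
    calc (n : ℝ)⁻¹ * |((xᴴ * y).trace).re| ≤ (n : ℝ)⁻¹ * (n * ‖x‖ * ‖y‖) := by gcongr
      _ = ‖x‖ * ‖y‖ := by field_simp

end Matrices

end TraceStateOfRecord

/-! ## §2. At the dictionary of record and at every family dictionary (`𝔸 = M₂(ℂ)` by `rfl`) -/

open TraceStateOfRecord

/-- ★★ **The coefficient algebra of the dictionary of record carries print's trace state** — the four clauses of node N24's K1-face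
display (`hN06`) at `stage3OfRecord₁₂.𝔸 = M₂(ℂ)`: `τ := tr`, `C_τ := 2` (`unfold; exact exists_traceState _`, size by unification: the carried `instCStar` is Mathlib's scoped
matrix C⋆-structure, `star = conjTranspose`, `‖·‖ =` the `L²`-operator norm, definitionally).
[cite: Balaban1987RG1, (0.2) p.252; Balaban1985RegularSpaces, p.76, (1.1) (bookkeeping: the record's coefficient algebra)] -/
theorem exists_traceState_stage3OfRecord₁₂ :
    ∃ (τ : stage3OfRecord₁₂.𝔸 →ₗ[ℂ] ℂ) (Cτ : ℝ),
      (∀ a : stage3OfRecord₁₂.𝔸, a ≠ 0 → 0 < (τ (star a * a)).re) ∧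
      (∀ a b : stage3OfRecord₁₂.𝔸, τ (a * b) = τ (b * a)) ∧
      (∀ a : stage3OfRecord₁₂.𝔸, τ (star a) = starRingEnd ℂ (τ a)) ∧
      (∀ x y : stage3OfRecord₁₂.𝔸, |(τ (star x * y)).re| ≤ Cτ * ‖x‖ * ‖y‖) := by
  unfold stage3OfRecord₁₂
  exact exists_traceState _

/-- ★★ **The same at every family dictionary `stage3OfFamily F`** (its `𝔸` IS the record's, `Record12NumericsColourTie.stage3OfFamily_𝔸_eq_record`):
the EXACT shape of the `(τ, C_τ)` clauses of node N24's K1-face binder `hN06`, so that the face takes them off its bill by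
`obtain ⟨τ, Cτ, hτp, hτt, hτs, hCτ⟩ := exists_traceState_stage3OfFamily F`.
[cite: Balaban1987RG1, (0.2) p.252; Balaban1985RegularSpaces, p.76, (1.1) (bookkeeping)] -/
theorem exists_traceState_stage3OfFamily (F : T4Family) :
    ∃ (τ : (stage3OfFamily F).𝔸 →ₗ[ℂ] ℂ) (Cτ : ℝ),
      (∀ a : (stage3OfFamily F).𝔸, a ≠ 0 → 0 < (τ (star a * a)).re) ∧
      (∀ a b : (stage3OfFamily F).𝔸, τ (a * b) = τ (b * a)) ∧
      (∀ a : (stage3OfFamily F).𝔸, τ (star a) = starRingEnd ℂ (τ a)) ∧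
      (∀ x y : (stage3OfFamily F).𝔸, |(τ (star x * y)).re| ≤ Cτ * ‖x‖ * ‖y‖) := by
  unfold stage3OfFamily stage3OfRecord₁₂
  exact exists_traceState _

/-- **Print-literal twin at the record**: the NORMALISED trace state (`τ 1 = 1`, `C_τ = 1`) on `stage3OfRecord₁₂.𝔸`.
[cite: Balaban1987RG1, (0.2) p.252 («tr 1 = 1»); Balaban1985RegularSpaces, p.76, (1.1) (bookkeeping)] -/
theorem exists_normalizedTraceState_stage3OfRecord₁₂ :
    ∃ (τ : stage3OfRecord₁₂.𝔸 →ₗ[ℂ] ℂ) (Cτ : ℝ), τ 1 = 1 ∧ Cτ = 1 ∧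
      (∀ a : stage3OfRecord₁₂.𝔸, a ≠ 0 → 0 < (τ (star a * a)).re) ∧
      (∀ a b : stage3OfRecord₁₂.𝔸, τ (a * b) = τ (b * a)) ∧
      (∀ a : stage3OfRecord₁₂.𝔸, τ (star a) = starRingEnd ℂ (τ a)) ∧
      (∀ x y : stage3OfRecord₁₂.𝔸, |(τ (star x * y)).re| ≤ Cτ * ‖x‖ * ‖y‖) := by
  unfold stage3OfRecord₁₂
  exact exists_normalizedTraceState _ (by norm_num)

/-- **Print-literal twin at every family dictionary**: the NORMALISED trace state (`τ 1 = 1`, `C_τ = 1`) on `(stage3OfFamily F).𝔸`.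
[cite: Balaban1987RG1, (0.2) p.252 («tr 1 = 1»); Balaban1985RegularSpaces, p.76, (1.1) (bookkeeping)] -/
theorem exists_normalizedTraceState_stage3OfFamily (F : T4Family) :
    ∃ (τ : (stage3OfFamily F).𝔸 →ₗ[ℂ] ℂ) (Cτ : ℝ), τ 1 = 1 ∧ Cτ = 1 ∧
      (∀ a : (stage3OfFamily F).𝔸, a ≠ 0 → 0 < (τ (star a * a)).re) ∧
      (∀ a b : (stage3OfFamily F).𝔸, τ (a * b) = τ (b * a)) ∧
      (∀ a : (stage3OfFamily F).𝔸, τ (star a) = starRingEnd ℂ (τ a)) ∧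
      (∀ x y : (stage3OfFamily F).𝔸, |(τ (star x * y)).re| ≤ Cτ * ‖x‖ * ‖y‖) := by
  unfold stage3OfFamily stage3OfRecord₁₂
  exact exists_normalizedTraceState _ (by norm_num)

end Literature.MathematicalPhysics.QuantumFieldTheory.Balaban1983to89.Node00

end
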